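import Summits.AtomisticToContinuum.FouriersLaw.Theses.ContactStieltjesMeasure

/-!
# Birth skeleton (BC3) for crux `ContactUpperDensity` — route `ContactStieltjesMeasure`
(item stmt-AtomisticToContinuum-15249, sub-problem `FouriersLaw`).

The crux (U) says: for every family `Φ_N` of contact distribution functions representing the
linear response at every friction `γ`, eventually in `N` one has `N·Φ_N(t) ≤ C·(1+t)` for all
`t > 0` (the scaled contact measure `N·μ̂_N` has at most linear cumulative mass at EVERY scale).

THREE-REGIME SPLIT (scales of the contact variable `t`, seam at `t = 1` and `t = N`):

* `stub_irUnitScaleMass`  — IR / FINITENESS regime `t ≤ 1`: `N·Φ_N(1) ≤ C₀` eventually in `N`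
  (the scaled contact measure puts `O(1)` mass below rate `1`; implied by bounded response at the
  single friction `γ = 1` via `Φ_N(γ) ≤ 2γ·G_N(γ)`, i.e. the `HasBoundedResponse` content at ONE
  coupling, and strictly weaker than (U)).
* `stub_bulkDyadicBand`   — BULK / NO-BUMP regime `1 ≤ t ≤ N`: every dyadic band `(t, 2t]` of
  interior relaxation rates carries at most linear scaled mass, `N·(Φ_N(2t) − Φ_N(t)) ≤ C₁·t`
  (doubling-scale upper regularity of `N·μ̂_N`; this isolates the 'mass bump at 1 ≪ t ≪ N'
  failure mode named in the crux docstring; tolerates integrable band-edge singularities that a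
  unit-window Wegner bound would not; strictly weaker than (U)).
* `stub_uvUniformMass`    — UV regime `t ≥ N`: the total contact mass is bounded UNIFORMLY in `N`,
  `Φ_N ≤ m` for `N ≥ N₂` (`m̂_N = lim_γ γ·G_N(γ)`, the strong-friction coefficient; expected
  `≤ ½·E_{μ_T}[U″(q₀)+V″(q₁−q₀)]`, the `CouplingFreeCeiling` technology — the provable piece).

`assembly_of_stubs` (sorry-free) derives the crux statement from the three stub statements by a dyadic
induction `N·Φ_N(2^j) ≤ A + K·2^j` (bulk step while `2^j ≤ N`, UV step beyond) and monotone interpolation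
between dyadic scales; `ContactUpperDensity_of : ContactUpperDensity` (by name) feeds in the declared stubs.
Sorries live ONLY in the three `stub_*` theorems.
-/

namespace Summit.AtomisticToContinuum.FouriersLaw.Cruxes.ContactUpperDensity.Birth

open Summit.AtomisticToContinuum.FouriersLaw.Theses.ContactStieltjesMeasure (ContactUpperDensity)

/-- stub 1 — IR / finiteness at unit scale: for every representing family `Φ` (same hypotheses as
the crux), `∃ C₀ N₀, ∀ N ≥ N₀, N·Φ_N(1) ≤ C₀`: the scaled contact measure `N·μ̂_N` has `O(1)` mass
on `(0,1]`. Consequence of bounded response at friction `γ = 1` (`N·G_N(1) ≤ C ⇒ N·Φ_N(1) ≤ 2C`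
by the Chebyshev lower bound `G_N(γ) ≥ Φ_N(γ)/(2γ)` of the layer-cake integral); false at
`lam = β = 0` (ballistic: `N·Φ_N(1) ≍ N`). Open (finiteness half of FL at one coupling). -/
theorem stub_irUnitScaleMass : ∀ ω₂ lam β : ℝ, 0 < ω₂ → 0 < lam → 0 < β → ∀ T : ℝ, 0 < T → ∀ Φ : ℕ → ℝ → ℝ, (∀ N : ℕ, 2 ≤ N → Monotone (Φ N) ∧ (∀ s : ℝ, s ≤ 0 → Φ N s = 0) ∧ (∃ m : ℝ, ∀ s : ℝ, Φ N s ≤ m) ∧ ∀ γ : ℝ, 0 < γ → (∀ (N' : ℕ) (T_L T_R : ℝ), 0 < T_L → 0 < T_R → ∀ μ ν : MeasureTheory.Measure (Literature.MathematicalPhysics.KineticTheory.HeatConduction.PhaseSpace N'), (Literature.MathematicalPhysics.KineticTheory.HeatConduction.pinnedChain ω₂ lam β γ).IsSteadyState N' T_L T_R μ → (Literature.MathematicalPhysics.KineticTheory.HeatConduction.pinnedChain ω₂ lam β γ).IsSteadyState N' T_L T_R ν → μ = ν) → ∀ μ : (N' : ℕ) → ℝ → ℝ → MeasureTheory.Measure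 (Literature.MathematicalPhysics.KineticTheory.HeatConduction.PhaseSpace N'), (∀ (N' : ℕ) (T_L T_R : ℝ), 0 < T_L → 0 < T_R → (Literature.MathematicalPhysics.KineticTheory.HeatConduction.pinnedChain ω₂ lam β γ).IsSteadyState N' T_L T_R (μ N' T_L T_R)) → Filter.Tendsto (fun δ : ℝ => (Literature.MathematicalPhysics.KineticTheory.HeatConduction.pinnedChain ω₂ lam β γ).totalCurrent (μ N (T + δ / 2) (T - δ / 2)) / δ) (nhdsWithin 0 {(0 : ℝ)}ᶜ) (nhds (((N : ℝ) - 1) * γ * ∫ t in Set.Ioi (0 : ℝ), Φ N t * (2 * t / (γ ^ 2 + t ^ 2) ^ 2)))) → ∃ C₀ : ℝ, ∃ N₀ : ℕ, ∀ N : ℕ, N₀ ≤ N → (N : ℝ) * Φ N 1 ≤ C₀ := by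
  sorry

/-- stub 2 — bulk / no dyadic bump on `[1, N]`: for every representing family `Φ`,
`∃ C₁ N₁, ∀ N ≥ N₁, ∀ t ∈ [1, N], N·(Φ_N(2t) − Φ_N(t)) ≤ C₁·t`: no dyadic band `(t,2t]` of
interior relaxation rates carries more than linear scaled contact mass (doubling-scale upper
`1`-regularity of `N·μ̂_N` in the bulk; the flat-density prediction gives `(2κ/π)·t`). This is the
LDOS / Wegner-type content of the route's two-layer plan in a form robust to integrable band-edge
singularities; it is where a 'mass bump at scales 1 ≪ t ≪ N' would refute the line. Open. -/
theorem stub_bulkDyadicBand : ∀ ω₂ lam β : ℝ, 0 < ω₂ → 0 < lam → 0 < β → ∀ T : ℝ, 0 < T → ∀ Φ : ℕ → ℝ → ℝ, (∀ N : ℕ, 2 ≤ N → Monotone (Φ N) ∧ (∀ s : ℝ, s ≤ 0 → Φ N s = 0) ∧ (∃ m : ℝ, ∀ s : ℝ, Φ N s ≤ m) ∧ ∀ γ : ℝ, 0 < γ → (∀ (N' : ℕ) (T_L T_R : ℝ), 0 < T_L → 0 < T_R → ∀ μ ν : MeasureTheory.Measure (Literature.MathematicalPhysics.KineticTheory.HeatConduction.PhaseSpace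 N'), (Literature.MathematicalPhysics.KineticTheory.HeatConduction.pinnedChain ω₂ lam β γ).IsSteadyState N' T_L T_R μ → (Literature.MathematicalPhysics.KineticTheory.HeatConduction.pinnedChain ω₂ lam β γ).IsSteadyState N' T_L T_R ν → μ = ν) → ∀ μ : (N' : ℕ) → ℝ → ℝ → MeasureTheory.Measure (Literature.MathematicalPhysics.KineticTheory.HeatConduction.PhaseSpace N'), (∀ (N' : ℕ) (T_L T_R : ℝ), 0 < T_L → 0 < T_R → (Literature.MathematicalPhysics.KineticTheory.HeatConduction.pinnedChain ω₂ lam β γ).IsSteadyState N' T_L T_R (μ N' T_L T_R)) → Filter.Tendsto (fun δ : ℝ => (Literature.MathematicalPhysics.KineticTheory.HeatConduction.pinnedChain ω₂ lam β γ).totalCurrent (μ N (T + δ / 2) (T - δ / 2)) / δ) (nhdsWithin 0 {(0 : ℝ)}ᶜ) (nhds (((N : ℝ) - 1) * γ * ∫ t in Set.Ioi (0 : ℝ), Φ N t * (2 * t / (γ ^ 2 + t ^ 2) ^ 2)))) → ∃ C₁ : ℝ, ∃ N₁ : ℕ, ∀ N : ℕ, N₁ ≤ N → ∀ t : ℝ,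 1 ≤ t → t ≤ (N : ℝ) → (N : ℝ) * (Φ N (2 * t) - Φ N t) ≤ C₁ * t := by
  sorry

/-- stub 3 — UV / N-uniform total contact mass: for every representing family `Φ`,
`∃ m N₂, ∀ N ≥ N₂, ∀ s, Φ_N(s) ≤ m`: the total mass `m̂_N = Φ_N(∞) = lim_{γ→∞} γ·G_N(γ)` of the
contact measure (the strong-friction coefficient `G_N(γ) ≈ m̂_N/γ`) is bounded uniformly in `N`
(expected `m̂_N ≤ ½·E_{μ_T}[U″(q₀) + V″(q₁ − q₀)]`, Gibbs integration by parts — the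
`CouplingFreeCeiling` technology). Beyond scale `t ≥ N` it makes the dyadic bound automatic
(`N·μ̂_N((t,2t]) ≤ N·m ≤ m·t`). Size M–L, provable once the K2 construction lands. -/
theorem stub_uvUniformMass : ∀ ω₂ lam β : ℝ, 0 < ω₂ → 0 < lam → 0 < β → ∀ T : ℝ, 0 < T → ∀ Φ : ℕ → ℝ → ℝ, (∀ N : ℕ, 2 ≤ N → Monotone (Φ N) ∧ (∀ s : ℝ, s ≤ 0 → Φ N s = 0) ∧ (∃ m : ℝ, ∀ s : ℝ, Φ N s ≤ m) ∧ ∀ γ : ℝ, 0 < γ → (∀ (N' : ℕ) (T_L T_R : ℝ), 0 < T_L → 0 < T_R → ∀ μ ν : MeasureTheory.Measure (Literature.MathematicalPhysics.KineticTheory.HeatConduction.PhaseSpace N'), (Literature.MathematicalPhysics.KineticTheory.HeatConduction.pinnedChain ω₂ lam β γ).IsSteadyState N' T_L T_R μ → (Literature.MathematicalPhysics.KineticTheory.HeatConduction.pinnedChain ω₂ lam β γ).IsSteadyState N' T_L T_R ν → μ = ν) → ∀ μ : (N' : ℕ) → ℝ → ℝ → MeasureTheory.Measure (Literature.MathematicalPhysics.KineticTheory.HeatConduction.PhaseSpace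 N'), (∀ (N' : ℕ) (T_L T_R : ℝ), 0 < T_L → 0 < T_R → (Literature.MathematicalPhysics.KineticTheory.HeatConduction.pinnedChain ω₂ lam β γ).IsSteadyState N' T_L T_R (μ N' T_L T_R)) → Filter.Tendsto (fun δ : ℝ => (Literature.MathematicalPhysics.KineticTheory.HeatConduction.pinnedChain ω₂ lam β γ).totalCurrent (μ N (T + δ / 2) (T - δ / 2)) / δ) (nhdsWithin 0 {(0 : ℝ)}ᶜ) (nhds (((N : ℝ) - 1) * γ * ∫ t in Set.Ioi (0 : ℝ), Φ N t * (2 * t / (γ ^ 2 + t ^ 2) ^ 2)))) → ∃ m : ℝ, ∃ N₂ : ℕ, ∀ N : ℕ, N₂ ≤ N → ∀ s : ℝ, Φ N s ≤ m := by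
  sorry

/-- ASSEMBLY LOGIC (kernel-checked, sorry-FREE closure — `#print axioms` = propext/Classical.choice/Quot.sound):
the three stub statements, taken as hypotheses, imply the crux statement (its body verbatim; the by-name corollary
`ContactUpperDensity_of` below feeds in the declared stubs). Proof: for `N ≥ max N₀ N₁ N₂ 2` a dyadic induction gives
`N·Φ_N(2^j) ≤ A + K·2^j` with `A = max C₀ 0`, `K = max (max C₁ m) 0` (bulk stub while `2^j ≤ N`, UV stub once
`N < 2^j`); for `t ≤ 1` monotonicity and the IR stub; for `t > 1` pick `2^j ≤ t < 2^(j+1)` (`exists_nat_pow_near`)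
and interpolate monotonically: `N·Φ_N(t) ≤ A + 2K·t ≤ (A + 2K)(1 + t)`. -/
theorem assembly_of_stubs
    (hIR : ∀ ω₂ lam β : ℝ, 0 < ω₂ → 0 < lam → 0 < β → ∀ T : ℝ, 0 < T → ∀ Φ : ℕ → ℝ → ℝ, (∀ N : ℕ, 2 ≤ N → Monotone (Φ N) ∧ (∀ s : ℝ, s ≤ 0 → Φ N s = 0) ∧ (∃ m : ℝ, ∀ s : ℝ, Φ N s ≤ m) ∧ ∀ γ : ℝ, 0 < γ → (∀ (N' : ℕ) (T_L T_R : ℝ), 0 < T_L → 0 < T_R → ∀ μ ν : MeasureTheory.Measure (Literature.MathematicalPhysics.KineticTheory.HeatConduction.PhaseSpace N'), (Literature.MathematicalPhysics.KineticTheory.HeatConduction.pinnedChain ω₂ lam β γ).IsSteadyState N' T_L T_R μ → (Literature.MathematicalPhysics.KineticTheory.HeatConduction.pinnedChain ω₂ lam β γ).IsSteadyState N' T_L T_R ν → μ = ν) → ∀ μ : (N' : ℕ) → ℝ → ℝ → MeasureTheory.Measure (Literature.MathematicalPhysics.KineticTheory.HeatConduction.PhaseSpace N'), (∀ (N' : ℕ)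 (T_L T_R : ℝ), 0 < T_L → 0 < T_R → (Literature.MathematicalPhysics.KineticTheory.HeatConduction.pinnedChain ω₂ lam β γ).IsSteadyState N' T_L T_R (μ N' T_L T_R)) → Filter.Tendsto (fun δ : ℝ => (Literature.MathematicalPhysics.KineticTheory.HeatConduction.pinnedChain ω₂ lam β γ).totalCurrent (μ N (T + δ / 2) (T - δ / 2)) / δ) (nhdsWithin 0 {(0 : ℝ)}ᶜ) (nhds (((N : ℝ) - 1) * γ * ∫ t in Set.Ioi (0 : ℝ), Φ N t * (2 * t / (γ ^ 2 + t ^ 2) ^ 2)))) → ∃ C₀ : ℝ, ∃ N₀ : ℕ, ∀ N : ℕ, N₀ ≤ N → (N : ℝ) * Φ N 1 ≤ C₀)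
    (hBulk : ∀ ω₂ lam β : ℝ, 0 < ω₂ → 0 < lam → 0 < β → ∀ T : ℝ, 0 < T → ∀ Φ : ℕ → ℝ → ℝ, (∀ N : ℕ, 2 ≤ N → Monotone (Φ N) ∧ (∀ s : ℝ, s ≤ 0 → Φ N s = 0) ∧ (∃ m : ℝ, ∀ s : ℝ, Φ N s ≤ m) ∧ ∀ γ : ℝ, 0 < γ → (∀ (N' : ℕ) (T_L T_R : ℝ), 0 < T_L → 0 < T_R → ∀ μ ν : MeasureTheory.Measure (Literature.MathematicalPhysics.KineticTheory.HeatConduction.PhaseSpace N'), (Literature.MathematicalPhysics.KineticTheory.HeatConduction.pinnedChain ω₂ lam β γ).IsSteadyState N' T_L T_R μ → (Literature.MathematicalPhysics.KineticTheory.HeatConduction.pinnedChain ω₂ lam β γ).IsSteadyState N' T_L T_R ν → μ = ν) → ∀ μ : (N' : ℕ) → ℝ → ℝ → MeasureTheory.Measure (Literature.MathematicalPhysics.KineticTheory.HeatConduction.PhaseSpace N'), (∀ (N' : ℕ) (T_L T_R : ℝ), 0 < T_L → 0 < T_R → (Literature.MathematicalPhysics.KineticTheory.HeatConduction.pinnedChain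 ω₂ lam β γ).IsSteadyState N' T_L T_R (μ N' T_L T_R)) → Filter.Tendsto (fun δ : ℝ => (Literature.MathematicalPhysics.KineticTheory.HeatConduction.pinnedChain ω₂ lam β γ).totalCurrent (μ N (T + δ / 2) (T - δ / 2)) / δ) (nhdsWithin 0 {(0 : ℝ)}ᶜ) (nhds (((N : ℝ) - 1) * γ * ∫ t in Set.Ioi (0 : ℝ), Φ N t * (2 * t / (γ ^ 2 + t ^ 2) ^ 2)))) → ∃ C₁ : ℝ, ∃ N₁ : ℕ, ∀ N : ℕ, N₁ ≤ N → ∀ t : ℝ, 1 ≤ t → t ≤ (N : ℝ) → (N : ℝ) * (Φ N (2 * t) - Φ N t) ≤ C₁ * t)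
    (hUV : ∀ ω₂ lam β : ℝ, 0 < ω₂ → 0 < lam → 0 < β → ∀ T : ℝ, 0 < T → ∀ Φ : ℕ → ℝ → ℝ, (∀ N : ℕ, 2 ≤ N → Monotone (Φ N) ∧ (∀ s : ℝ, s ≤ 0 → Φ N s = 0) ∧ (∃ m : ℝ, ∀ s : ℝ, Φ N s ≤ m) ∧ ∀ γ : ℝ, 0 < γ → (∀ (N' : ℕ) (T_L T_R : ℝ), 0 < T_L → 0 < T_R → ∀ μ ν : MeasureTheory.Measure (Literature.MathematicalPhysics.KineticTheory.HeatConduction.PhaseSpace N'), (Literature.MathematicalPhysics.KineticTheory.HeatConduction.pinnedChain ω₂ lam β γ).IsSteadyState N' T_L T_R μ → (Literature.MathematicalPhysics.KineticTheory.HeatConduction.pinnedChain ω₂ lam β γ).IsSteadyState N' T_L T_R ν → μ = ν) → ∀ μ : (N' : ℕ) → ℝ → ℝ → MeasureTheory.Measure (Literature.MathematicalPhysics.KineticTheory.HeatConduction.PhaseSpace N'), (∀ (N' : ℕ) (T_L T_R : ℝ), 0 < T_L → 0 < T_R → (Literature.MathematicalPhysics.KineticTheory.HeatConduction.pinnedChain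 ω₂ lam β γ).IsSteadyState N' T_L T_R (μ N' T_L T_R)) → Filter.Tendsto (fun δ : ℝ => (Literature.MathematicalPhysics.KineticTheory.HeatConduction.pinnedChain ω₂ lam β γ).totalCurrent (μ N (T + δ / 2) (T - δ / 2)) / δ) (nhdsWithin 0 {(0 : ℝ)}ᶜ) (nhds (((N : ℝ) - 1) * γ * ∫ t in Set.Ioi (0 : ℝ), Φ N t * (2 * t / (γ ^ 2 + t ^ 2) ^ 2)))) → ∃ m : ℝ, ∃ N₂ : ℕ, ∀ N : ℕ, N₂ ≤ N → ∀ s : ℝ, Φ N s ≤ m) :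
    ∀ ω₂ lam β : ℝ, 0 < ω₂ → 0 < lam → 0 < β → ∀ T : ℝ, 0 < T → ∀ Φ : ℕ → ℝ → ℝ, (∀ N : ℕ, 2 ≤ N → Monotone (Φ N) ∧ (∀ s : ℝ, s ≤ 0 → Φ N s = 0) ∧ (∃ m : ℝ, ∀ s : ℝ, Φ N s ≤ m) ∧ ∀ γ : ℝ, 0 < γ → (∀ (N' : ℕ) (T_L T_R : ℝ), 0 < T_L → 0 < T_R → ∀ μ ν : MeasureTheory.Measure (Literature.MathematicalPhysics.KineticTheory.HeatConduction.PhaseSpace N'), (Literature.MathematicalPhysics.KineticTheory.HeatConduction.pinnedChain ω₂ lam β γ).IsSteadyState N' T_L T_R μ → (Literature.MathematicalPhysics.KineticTheory.HeatConduction.pinnedChain ω₂ lam β γ).IsSteadyState N' T_L T_R ν → μ = ν) → ∀ μ : (N' : ℕ) → ℝ → ℝ → MeasureTheory.Measure (Literature.MathematicalPhysics.KineticTheory.HeatConduction.PhaseSpace N'), (∀ (N' : ℕ) (T_L T_R : ℝ), 0 < T_L → 0 < T_R → (Literature.MathematicalPhysics.KineticTheory.HeatConduction.pinnedChain ω₂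 lam β γ).IsSteadyState N' T_L T_R (μ N' T_L T_R)) → Filter.Tendsto (fun δ : ℝ => (Literature.MathematicalPhysics.KineticTheory.HeatConduction.pinnedChain ω₂ lam β γ).totalCurrent (μ N (T + δ / 2) (T - δ / 2)) / δ) (nhdsWithin 0 {(0 : ℝ)}ᶜ) (nhds (((N : ℝ) - 1) * γ * ∫ t in Set.Ioi (0 : ℝ), Φ N t * (2 * t / (γ ^ 2 + t ^ 2) ^ 2)))) → ∃ C : ℝ, ∃ N₀ : ℕ, ∀ N : ℕ, N₀ ≤ N → ∀ t : ℝ, 0 < t → (N : ℝ) * Φ N t ≤ C * (1 + t) := by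
  intro ω₂ lam β hω hl hβ T hT Φ hΦ
  obtain ⟨C₀, N₀, hC₀⟩ := hIR ω₂ lam β hω hl hβ T hT Φ hΦ
  obtain ⟨C₁, N₁, hC₁⟩ := hBulk ω₂ lam β hω hl hβ T hT Φ hΦ
  obtain ⟨m, N₂, hm⟩ := hUV ω₂ lam β hω hl hβ T hT Φ hΦ
  -- absorbing constants `A ≥ max C₀ 0`, `K ≥ max C₁ m 0`
  obtain ⟨A, hA0, hC₀A⟩ : ∃ A : ℝ, 0 ≤ A ∧ C₀ ≤ A := ⟨max C₀ 0, le_max_right _ _, le_max_left _ _⟩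
  obtain ⟨K, hK0, hC₁K, hmK⟩ : ∃ K : ℝ, 0 ≤ K ∧ C₁ ≤ K ∧ m ≤ K :=
    ⟨max (max C₁ m) 0, le_max_right _ _, (le_max_left _ _).trans (le_max_left _ _),
      (le_max_right _ _).trans (le_max_left _ _)⟩
  refine ⟨A + 2 * K, max (max N₀ N₁) (max N₂ 2), ?_⟩
  intro N hN t ht
  have hN₀ : N₀ ≤ N := le_of_max_le_left (le_of_max_le_left hN)
  have hN₁ : N₁ ≤ N := le_of_max_le_right (le_of_max_le_left hN)
  have hN₂ : N₂ ≤ N := le_of_max_le_left (le_of_max_le_right hN)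
  have h2N : 2 ≤ N := le_of_max_le_right (le_of_max_le_right hN)
  have hmono : Monotone (Φ N) := (hΦ N h2N).1
  have hzero : Φ N 0 = 0 := (hΦ N h2N).2.1 0 le_rfl
  have hNpos : (0 : ℝ) ≤ (N : ℝ) := Nat.cast_nonneg N
  have hm0 : 0 ≤ m := by
    have h := hm N hN₂ 0
    rwa [hzero] at h
  -- base of the dyadic ladder: the IR stub at scale 1
  have base : (N : ℝ) * Φ N 1 ≤ A := (hC₀ N hN₀).trans hC₀A
  -- dyadic ladder: bulk stub while `2^j ≤ N`, UV stub beyond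
  have dyadic : ∀ j : ℕ, (N : ℝ) * Φ N ((2 : ℝ) ^ j) ≤ A + K * (2 : ℝ) ^ j := by
    intro j
    induction j with
    | zero =>
      simp only [pow_zero, mul_one]
      linarith [base, hK0]
    | succ j ih =>
      have hpow1 : (1 : ℝ) ≤ (2 : ℝ) ^ j := one_le_pow₀ (by norm_num)
      have hpowpos : (0 : ℝ) < (2 : ℝ) ^ j := by positivity
      have hsucc : (2 : ℝ) ^ (j + 1) = 2 * (2 : ℝ) ^ j := by rw [pow_succ]; ring
      by_cases hjN : (2 : ℝ) ^ j ≤ (N : ℝ)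
      · -- bulk step
        have hb := hC₁ N hN₁ ((2 : ℝ) ^ j) hpow1 hjN
        have hCK : C₁ * (2 : ℝ) ^ j ≤ K * (2 : ℝ) ^ j := mul_le_mul_of_nonneg_right hC₁K hpowpos.le
        calc (N : ℝ) * Φ N ((2 : ℝ) ^ (j + 1))
            = (N : ℝ) * Φ N ((2 : ℝ) ^ j) + (N : ℝ) * (Φ N (2 * (2 : ℝ) ^ j) - Φ N ((2 : ℝ) ^ j)) := by
              rw [hsucc]; ring
          _ ≤ (A + K * (2 : ℝ) ^ j) + C₁ * (2 : ℝ) ^ j := add_le_add ih hb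
          _ ≤ (A + K * (2 : ℝ) ^ j) + K * (2 : ℝ) ^ j := by linarith [hCK]
          _ = A + K * (2 : ℝ) ^ (j + 1) := by rw [hsucc]; ring
      · -- UV step: `N < 2^j`
        have hjN' : (N : ℝ) < (2 : ℝ) ^ j := lt_of_not_ge hjN
        calc (N : ℝ) * Φ N ((2 : ℝ) ^ (j + 1))
            ≤ (N : ℝ) * m := mul_le_mul_of_nonneg_left (hm N hN₂ _) hNpos
          _ ≤ (2 : ℝ) ^ j * m := mul_le_mul_of_nonneg_right hjN'.le hm0
          _ ≤ (2 : ℝ) ^ j * K := mul_le_mul_of_nonneg_left hmK hpowpos.le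
          _ ≤ A + K * (2 : ℝ) ^ (j + 1) := by
              rw [hsucc]
              nlinarith [hA0, hK0, hpowpos]
  -- interpolation between dyadic scales
  by_cases ht1 : t ≤ 1
  · calc (N : ℝ) * Φ N t ≤ (N : ℝ) * Φ N 1 := mul_le_mul_of_nonneg_left (hmono ht1) hNpos
      _ ≤ A := base
      _ ≤ (A + 2 * K) * (1 + t) := by nlinarith [hA0, hK0, ht]
  · have ht1' : (1 : ℝ) < t := lt_of_not_ge ht1
    obtain ⟨j, hj1, hj2⟩ := _root_.exists_nat_pow_near ht1'.le (by norm_num : (1 : ℝ) < 2)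
    have hstep : K * (2 : ℝ) ^ (j + 1) ≤ 2 * K * t := by
      rw [pow_succ]
      nlinarith [hK0, hj1]
    calc (N : ℝ) * Φ N t ≤ (N : ℝ) * Φ N ((2 : ℝ) ^ (j + 1)) :=
          mul_le_mul_of_nonneg_left (hmono hj2.le) hNpos
      _ ≤ A + K * (2 : ℝ) ^ (j + 1) := dyadic (j + 1)
      _ ≤ A + 2 * K * t := by linarith [hstep]
      _ ≤ (A + 2 * K) * (1 + t) := by nlinarith [hA0, hK0, ht]

/-- THE SKELETON THEOREM (A12 shape, `#h21_check_skeleton`): concludes the crux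
`Theses.ContactStieltjesMeasure.ContactUpperDensity` BY NAME, no hypotheses, no `sorry` of its own — its only
non-whitelisted dependencies are the three DECLARED stubs, fed by name into the sorry-free `assembly_of_stubs`. -/
theorem ContactUpperDensity_of :
    Summit.AtomisticToContinuum.FouriersLaw.Theses.ContactStieltjesMeasure.ContactUpperDensity :=
  assembly_of_stubs stub_irUnitScaleMass stub_bulkDyadicBand stub_uvUniformMass

end Summit.AtomisticToContinuum.FouriersLaw.Cruxes.ContactUpperDensity.Birth
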